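/-
Copyright (c) 2026 the pub-hodgecm-mathlib formalisation cell (harness21).  Prover seat hodgecm-mathlib-K2E5-p17 (g7): Track B «K2-LIT»,
hLiu418 = stmt-HodgeConjecture-24832; ROAD Φ of socket #41, organ Φ3d input (d1) (co-dealer K2E5-plan (g7) 12:01:57Z; consumer K2Liu-p12 (g3)
`K2LiuWhittakerDeltaEulerHead` (d3) ∕ `…IntegrandFactorisation` (d2); census `K2/K2E5-p17/g7/CENSUS-d1-…K2E5-p17-g7.md`).  2026-09-04.
-/
import Summits.HodgeConjecture.HodgeConjecture.Theorems.K2LiuSiegelUnipotentCharacters    -- ★ Φ1 CHARACTERS (K2Liu-p06): `unipDeltaChar_mul`, `ringHom_map_trace`, `toBlocks₁₂_blk_one`; brings Φ1 DEFS `unipDeltaChar`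
import Summits.HodgeConjecture.HodgeConjecture.Theorems.K2LiuSiegelUnipotentSplitDefs       -- ★ Φ3b DEFS 1–2 (K2Liu-p03): `unipDeltaLoc`, `unipDeltaArch`, `unipDeltaSplit` (+ coordinates by `rfl`)
import Literature.NumberTheory.Automorphic.AdeleAddCharProductFormula                       -- ★ Tate 3.2.1 `map_eq_mul_finprod_adicComponent`; brings `AddChar.adicComponent`, `adeleAddCharAt_eq_one_of_mem`
import Literature.NumberTheory.Automorphic.UnitaryGroupArchToAdelicPlaces                   -- ★ `coe_archToAdelic_apply` (the adelic matrix of `(a, 1)`)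
import Literature.NumberTheory.GelbartRogawski1991.DoubledUnitarySiegelPlaceComponents      -- ★ `coe_finAdelicToAdelic_apply`, `coe_evalAt_inclPlace_of_over∕_of_not_over`
import Literature.NumberTheory.Automorphic.AdicCompletionIntegerSpellings                    -- ★ `mem_valuationInteger_iff_mem_valuedInteger` (the two spellings of `𝒪_w`)
import HarnessLib

/-!
# Crux `HLiu418`, ROAD Φ, organ Φ3d input (d1): THE UNIPOTENT CHARACTER `ψ_S` OF `N_Δ(𝔸)` FACTORS PLACE BY PLACE
# `ψ_S(u) = ψ_S(u_∞, 1) · ∏_v ψ_S(ι_v u_v)`, the local characters being `ψ_{S,v} := ψ_S ∘ ι_v = ∏_{w∣v} ψ_{L,w}(tr(S X_w(·)))`, unramified off a finite set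

Cell `hodgecm-mathlib`, crux item hLiu418 = `stmt-HodgeConjecture-24832`, route of record `HCCMUnconditional`; squad K2 ∕ K2Liu, Road Φ of socket #41
`sig_K2LiuSiegelEisensteinContinuation`, organ Φ3d (Euler product of the Fourier coefficient `W_S(f_s)(h)`, consumer files (d2)∕(d3) of K2Liu-p12 (g3),
`CENSUS-G1-WhittakerDeltaEulerHead.K2Liu-p12-g3.md` §cut (d1)).  THEOREMS ONLY (no `def`, no instance, no notation, no named-fact hypothesis, no `sorry`);
lane `--supports stmt-HodgeConjecture-24832 --as helper` (count-neutral).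

THE LETTERS (definition-free).  ★ Φ1 `unipDeltaChar S u = ψ_L(tr(S_𝔸 · X(u)))`, `X(u) = (blk u)₁₂ ∈ M_n(𝔸_L)`, `ψ_L` = ★ `adeleAddChar L` (Tate).  The LOCAL CHARACTER at a
finite place `v` of `L⁺` is the global one read through the place inclusion ★ `locToAdelic v = ι_v : H(L⁺_v) → H(𝔸)`:
`ψ_{S,v} := unipDeltaChar S ∘ ι_v`, and the archimedean one is `ψ_{S,∞} := unipDeltaChar S ∘ archToAdelic`.  Since the adele `tr(S_𝔸 · X(ι_v y))` is
`(0; (tr(S_w X(y_w)))_{w∣v}, 0 elsewhere)`, Tate's product formula gives `ψ_{S,v}(y) = ∏_{w∣v} ψ_{L,w}(tr(S_w · X(y_w)))` — the classical local character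
[Shimura1997, §18.1 (18.4)], [KudlaRallis1994, §2] — with no local chart to define.
CONTENTS.
* §1 generic: `finprod_eq_finprod_prod_fiber` (regrouping `∏ᶠ_w = ∏ᶠ_v ∏_{w∣v}`), `map_trace_mul_toBlocks₁₂` (`φ(tr(T·X(U))) = tr(φT · X(φU))` for a ring hom `φ`),
  `toBlocks₁₂_reindex_one` (`X(1) = 0`).
* §2 the adele `tr(S_𝔸 X(u))` componentwise for `u`, for `(u_∞, 1) = archToAdelic (archPart u)` and for `ι_v y`: `fst`∕`w`-components (★ `coe_archToAdelic_apply`,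
  ★ `coe_finAdelicToAdelic_apply`, ★ `coe_evalAt_inclPlace_of_over∕_of_not_over`, ★ `coe_evalPlace_apply`).
* §3 **`unipDeltaChar_locToAdelic_eq_prod`** — the local formula `ψ_S(ι_v y) = ∏_{w∣v} ψ_{L,w}(tr(S X(u))_w)`; **`unipDeltaChar_archToAdelic_archPart`** — `ψ_S(u_∞,1) = ψ_L(x_∞, 0)`;
  **`unipDeltaChar_eq_archPart_mul_finprod`** — THE PRODUCT FORMULA `ψ_S(u) = ψ_S(u_∞, 1) · ∏ᶠ_v ψ_S(ι_v u_v)` for every `u ∈ H(𝔸)` (★ Tate 3.2.1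
  `map_eq_mul_finprod_adicComponent` + §1∕§2), and its `unipDeltaSplit`-coordinate ∕ `(F)`-shape forms for ★ Φ3c `integral_unipDelta_eq_mul_tprod`.
* §4 **unramified places**: `unipDeltaChar_locToAdelic_eq_one_of_integral` — if `S` is `w`-integral for all `w ∣ v` then `ψ_{S,v} ≡ 1` on `K_{H,v} ∩ N_Δ(L⁺_v)`
  (★ `adeleAddCharAt_eq_one_of_mem`: Tate's `ψ_{L,w}` is trivial on `𝒪_w` at EVERY `w` — no ramification condition), and `exists_finset_forall_integral`
  (`S ∈ M_n(L)` is integral at all `w ∣ v` for `v` off a finite set), so the (F)-shape is unramified off `T ⊇ T₀(S)`.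
HONEST LABEL: HC_CM is proved only modulo the 7 printed citations (2 remaining named inputs: hLiu418 = stmt-HodgeConjecture-24832,
h413 = stmt-HodgeConjecture-24833) until rung 0 closes; this file is a count-neutral helper and closes no socket by itself.

## Mathlib ∕ tree search
Tree ★: `AdeleAddCharProductFormula.map_eq_mul_finprod_adicComponent`, `continuous_adeleAddChar`, `AddChar.adicComponent_apply`, `adeleAddCharAt_eq_one_of_mem`,
`adeleSingleHom_apply_fst∕_snd`, `infiniteAdeleInl_apply`, `GLn.coe_ofInfinite_apply`∕`coe_archToAdelic_apply`, `coe_finAdelicToAdelic_apply`, `GLn.coe_evalAt_apply`,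
`coe_evalAt_inclPlace_of_over∕_of_not_over`, `coe_evalPlace_apply`, `coe_finPart`, `coe_archPart`, `mem_localInt_iff`, `mem_glInt_iff`, Φ1 `ringHom_map_trace`,
`toBlocks_reindex_e₂_map`, `unipDeltaChar_apply`, `coe_unipDeltaSplit_fst∕_snd_apply`.  Mathlib: `finprod_eq_prod_of_mulSupport_subset`, `Finset.prod_fiberwise_of_maps_to`,
`Finset.mulSupport_of_fiberwise_prod_subset_image`, `finprod_mem_eq_prod_of_subset`, `RestrictedProduct` coercions.  Dedup: `rg "unipDeltaChar.*locToAdelic|CharacterFactorisation"` — none.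

## References
* [CasselsFrohlichANT1967] J. Tate, *Fourier analysis in number fields and Hecke's zeta-functions*, in Cassels–Fröhlich (eds.), *Algebraic Number Theory* (1967), Ch. XV, Lemma 3.2.1, §4.1.
* [Shimura1997] G. Shimura, *Euler products and Eisenstein series*, CBMS 93 (1997), §18.1 (18.4), §18.3.
* [KudlaRallis1994] S. Kudla, S. Rallis, *A regularized Siegel–Weil formula: the first term identity*, Ann. of Math. 140 (1994), §2.
* [Tan1999] V. Tan, *Poles of Siegel Eisenstein series on U(n,n)*, Canad. J. Math. 51 (1999), §2–§3.
-/

set_option autoImplicit false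
-- the mandated namespace repeats the single-problem summit's segment (`HodgeConjecture.HodgeConjecture`)
set_option linter.dupNamespace false

noncomputable section

open scoped Matrix RestrictedProduct
open NumberField IsDedekindDomain Function Set
open Literature.NumberTheory.Automorphic Literature.NumberTheory.GaloisRepresentations
open Literature.NumberTheory.GelbartRogawski1991 Literature.NumberTheory.GelbartRogawski1991.GRConstruction
open Literature.NumberTheory.K2Lit.SiegelDoubled
open Literature.Topology.Algebra.RestrictedProduct (inH)

namespace Summit.HodgeConjecture.HodgeConjecture.Cruxes.HLiu418.K2LiuSiegelUnipotentCharacterFactorisation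

open Summit.HodgeConjecture.HodgeConjecture.Cruxes.HLiu418.K2LiuSiegelUnipotentFourierDefs
open Summit.HodgeConjecture.HodgeConjecture.Cruxes.HLiu418.K2LiuSiegelUnipotentCharacters (ringHom_map_trace toBlocks₁₂_blk_one unipDeltaChar_mul)
open Summit.HodgeConjecture.HodgeConjecture.Cruxes.HLiu418.K2LiuSiegelUnipotentLocalDefs
open Summit.HodgeConjecture.HodgeConjecture.Cruxes.HLiu418.K2LiuSiegelUnipotentSplitDefs

/-! ## §1 Generic: regrouping a finite product along fibres; the `(1,2)`-block trace under a ring homomorphism -/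

section Generic

/-- **Regrouping a finitely supported product along the (finite) fibres of a map**: `∏ᶠ_b f b = ∏ᶠ_k ∏_{b : g b = k} f b` — used with `g = (w ↦ w ∩ 𝓞_{L⁺})`
(`∏ᶠ` over the places of `L` = `∏ᶠ` over the places of `L⁺` of the products over the places above). [cite: CasselsFrohlichANT1967, Ch. XV (Tate), §4.1] -/
theorem finprod_eq_finprod_prod_fiber {β κ R : Type*} [CommMonoid R] (g : β → κ) [∀ k, Fintype {b // g b = k}] (f : β → R)
    (hf : (mulSupport f).Finite) : ∏ᶠ b, f b = ∏ᶠ k, ∏ b : {b // g b = k}, f b.1 := by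
  classical
  set s : Finset β := hf.toFinset with hs_def
  have hs : mulSupport f ⊆ s := by simp [hs_def]
  have hinner : ∀ k, ∏ b : {b // g b = k}, f b.1 = ∏ b ∈ s.filter (fun b => g b = k), f b := by
    intro k
    rw [← finprod_eq_prod_of_fintype, finprod_subtype_eq_finprod_cond]
    refine finprod_mem_eq_prod_of_subset f ?_ ?_
    · intro b hb
      rw [Finset.coe_filter]
      exact ⟨hs hb.2, hb.1⟩
    · intro b hb
      rw [Finset.coe_filter] at hb
      exact hb.2
  simp_rw [hinner]
  rw [finprod_eq_prod_of_mulSupport_subset _ (s.mulSupport_of_fiberwise_prod_subset_image f g), finprod_eq_prod_of_mulSupport_subset f hs]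
  exact (Finset.prod_fiberwise_of_maps_to (fun b hb => Finset.mem_image_of_mem g hb) f).symm

variable {R R' : Type*} [CommRing R] [CommRing R'] {n : ℕ}

/-- the `(1,2)`-block trace `tr(T · X(U))`, `X(U) = (reindex e₂⁻¹ e₂⁻¹ U)₁₂`, commutes with ring homomorphisms (★ `ringHom_map_trace`, ★ `toBlocks_reindex_e₂_map`).
[cite: Shimura1997, §18.1] -/
theorem map_trace_mul_toBlocks₁₂ (φ : R →+* R') (T : Matrix (Fin n) (Fin n) R) (U : Matrix (Fin (n + n)) (Fin (n + n)) R) :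
    φ (Matrix.trace (T * (Matrix.reindex (e₂ (n := n)).symm (e₂ (n := n)).symm U).toBlocks₁₂)) = Matrix.trace (T.map φ * (Matrix.reindex (e₂ (n := n)).symm (e₂ (n := n)).symm (U.map φ)).toBlocks₁₂) := by
  rw [ringHom_map_trace, Matrix.map_mul, (toBlocks_reindex_e₂_map (n := n) (φ : R → R') U).2.1]

/-- `X(1) = 0`: the `(1,2)`-block of the identity vanishes. [cite: Shimura1997, §18.1] -/
theorem toBlocks₁₂_reindex_one : (Matrix.reindex (e₂ (n := n)).symm (e₂ (n := n)).symm (1 : Matrix (Fin (n + n)) (Fin (n + n)) R)).toBlocks₁₂ = 0 := by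
  rw [Matrix.reindex_apply, Matrix.submatrix_one_equiv, ← Matrix.fromBlocks_one, Matrix.toBlocks_fromBlocks₁₂]

/-- hence `tr(T · X(1)) = 0`. [cite: Shimura1997, §18.1] -/
theorem trace_mul_toBlocks₁₂_one (T : Matrix (Fin n) (Fin n) R) : Matrix.trace (T * (Matrix.reindex (e₂ (n := n)).symm (e₂ (n := n)).symm (1 : Matrix (Fin (n + n)) (Fin (n + n)) R)).toBlocks₁₂) = 0 := by
  rw [toBlocks₁₂_reindex_one, Matrix.mul_zero, Matrix.trace_zero]

end Generic

/-! ## §2 The adelic matrices of `u`, of `(u_∞, 1) = archToAdelic (archPart u)` and of `ι_v y`, componentwise -/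

section Components

variable (L : Type) [Field L] [NumberField L] [IsCMField L]
variable {N M n : ℕ} (e : Fin N × Fin M ≃ Fin n)
  (dV : Fin N → L) (hdV : ∀ i, IsCMField.complexConj L (dV i) = dV i)
  (dW : Fin M → L) (hdW : ∀ i, IsCMField.complexConj L (dW i) = dW i)

/-- the archimedean part of the matrix of `(u_∞, 1)` is that of `u` (★ `coe_archToAdelic_apply`: the entries of `(a, 1)` are `(e⁻¹ a_{ij}, δ_{ij})`, and
`(archPart u)_{ij} = e (u_{ij})_∞`). [cite: CasselsFrohlichANT1967, Ch. XV (Tate), §4.1] -/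
theorem map_fst_archToAdelic_archPart (u : (HA L e dV hdV dW hdW)) :
    ((((UnitaryGroup.archToAdelic (Fp L) L (IsCMField.complexConj L) (n + n) (hermD L e dV hdV dW hdW)) ((UnitaryGroup.archPart (Fp L) L (IsCMField.complexConj L) (n + n) (hermD L e dV hdV dW hdW)) u)).1 : GL (Fin (n + n)) (AdeleRing (𝓞 L) L)) : Matrix (Fin (n + n)) (Fin (n + n)) (AdeleRing (𝓞 L) L)).map (UnitaryGroup.adeleFst L) = (((u : (HA L e dV hdV dW hdW)) : GL (Fin (n + n)) (AdeleRing (𝓞 L) L)) : Matrix (Fin (n + n)) (Fin (n + n)) (AdeleRing (𝓞 L) L)).map (UnitaryGroup.adeleFst L) := by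
  refine Matrix.ext fun i j => ?_
  change (((((UnitaryGroup.archToAdelic (Fp L) L (IsCMField.complexConj L) (n + n) (hermD L e dV hdV dW hdW)) ((UnitaryGroup.archPart (Fp L) L (IsCMField.complexConj L) (n + n) (hermD L e dV hdV dW hdW)) u)).1 : GL (Fin (n + n)) (AdeleRing (𝓞 L) L)) : Matrix (Fin (n + n)) (Fin (n + n)) (AdeleRing (𝓞 L) L)) i j).1 = ((((u : (HA L e dV hdV dW hdW)) : GL (Fin (n + n)) (AdeleRing (𝓞 L) L)) : Matrix (Fin (n + n)) (Fin (n + n)) (AdeleRing (𝓞 L) L)) i j).1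
  rw [UnitaryGroup.coe_archToAdelic_apply]
  exact (InfiniteAdeleRing.ringEquiv_mixedSpace L).symm_apply_apply _

/-- … and its component at every finite place `w` of `L` is the identity matrix. [cite: CasselsFrohlichANT1967, Ch. XV (Tate), §4.1] -/
theorem map_adeleEval_archToAdelic_archPart (u : (HA L e dV hdV dW hdW)) (w : (HeightOneSpectrum (𝓞 L))) :
    ((((UnitaryGroup.archToAdelic (Fp L) L (IsCMField.complexConj L) (n + n) (hermD L e dV hdV dW hdW)) ((UnitaryGroup.archPart (Fp L) L (IsCMField.complexConj L) (n + n) (hermD L e dV hdV dW hdW)) u)).1 : GL (Fin (n + n)) (AdeleRing (𝓞 L) L)) : Matrix (Fin (n + n)) (Fin (n + n)) (AdeleRing (𝓞 L) L)).map (AdelicGroupData.adeleEval L w) = 1 := by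
  rw [show ((AdelicGroupData.adeleEval L w) : (AdeleRing (𝓞 L) L) → w.adicCompletion L) = (AdelicGroupData.finiteAdeleEval L w) ∘ (UnitaryGroup.adeleSnd L) from rfl,
    ← Matrix.map_map, UnitaryGroup.map_snd_coe_archToAdelic]
  exact Matrix.map_one _ (map_zero _) (map_one _)

variable (v : (HeightOneSpectrum (𝓞 (Fp L))))

/-- the archimedean part of the matrix of `ι_v y` is the identity (★ `coe_finAdelicToAdelic_apply`). [cite: CasselsFrohlichANT1967, Ch. XV (Tate), §4.1] -/
theorem map_fst_locToAdelic (y : (UnitaryGroup.localPi L (IsCMField.complexConj L) (n + n) (hermD L e dV hdV dW hdW) v)) : ((((locToAdelic L e dV hdV dW hdW v) y).1 : GL (Fin (n + n)) (AdeleRing (𝓞 L) L)) : Matrix (Fin (n + n)) (Fin (n + n)) (AdeleRing (𝓞 L) L)).map (UnitaryGroup.adeleFst L) = 1 :=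
  map_fst_coe_finAdelicToAdelic L e dV hdV dW hdW _

/-- the component of the matrix of `ι_v y` at a place `w ∣ v` is the matrix `y_w` (★ `coe_evalAt_inclPlace_of_over`). [cite: CasselsFrohlichANT1967, Ch. XV (Tate), §4.1] -/
theorem map_adeleEval_locToAdelic_of_over (y : (UnitaryGroup.localPi L (IsCMField.complexConj L) (n + n) (hermD L e dV hdV dW hdW) v)) (w : UnitaryGroup.PlacesOver L v) :
    ((((locToAdelic L e dV hdV dW hdW v) y).1 : GL (Fin (n + n)) (AdeleRing (𝓞 L) L)) : Matrix (Fin (n + n)) (Fin (n + n)) (AdeleRing (𝓞 L) L)).map (AdelicGroupData.adeleEval L w.1) = ((((y : (UnitaryGroup.localPi L (IsCMField.complexConj L) (n + n) (hermD L e dV hdV dW hdW) v)) : (UnitaryGroup.LocalGLPi L (n + n) v)) w : GL (Fin (n + n)) (w.1.adicCompletion L)) : Matrix (Fin (n + n)) (Fin (n + n)) (w.1.adicCompletion L)) := by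
  rw [show ((AdelicGroupData.adeleEval L w.1) : (AdeleRing (𝓞 L) L) → w.1.adicCompletion L) = (AdelicGroupData.finiteAdeleEval L w.1) ∘ (UnitaryGroup.adeleSnd L) from rfl,
    ← Matrix.map_map, show ((((locToAdelic L e dV hdV dW hdW v) y).1 : GL (Fin (n + n)) (AdeleRing (𝓞 L) L)) : Matrix (Fin (n + n)) (Fin (n + n)) (AdeleRing (𝓞 L) L)).map (UnitaryGroup.adeleSnd L) = (((UnitaryGroup.inclPlace (Fp L) L (IsCMField.complexConj L) (n + n) (hermD L e dV hdV dW hdW) v y : UnitaryGroup.finAdelic (Fp L) L (IsCMField.complexConj L) (n + n) (hermD L e dV hdV dW hdW)) : GL (Fin (n + n)) (FiniteAdeleRing (𝓞 L) L)) : Matrix (Fin (n + n)) (Fin (n + n)) (FiniteAdeleRing (𝓞 L) L)) from map_snd_coe_finAdelicToAdelic L e dV hdV dW hdW _,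
    UnitaryGroup.map_eval_eq_evalAt]
  exact coe_evalAt_inclPlace_of_over L e dV hdV dW hdW v y w

/-- … and at a place `w ∤ v` it is the identity (★ `coe_evalAt_inclPlace_of_not_over`). [cite: CasselsFrohlichANT1967, Ch. XV (Tate), §4.1] -/
theorem map_adeleEval_locToAdelic_of_not_over (y : (UnitaryGroup.localPi L (IsCMField.complexConj L) (n + n) (hermD L e dV hdV dW hdW) v)) (w : (HeightOneSpectrum (𝓞 L))) (hw : w.under (𝓞 (Fp L)) ≠ v) :
    ((((locToAdelic L e dV hdV dW hdW v) y).1 : GL (Fin (n + n)) (AdeleRing (𝓞 L) L)) : Matrix (Fin (n + n)) (Fin (n + n)) (AdeleRing (𝓞 L) L)).map (AdelicGroupData.adeleEval L w) = 1 := by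
  rw [show ((AdelicGroupData.adeleEval L w) : (AdeleRing (𝓞 L) L) → w.adicCompletion L) = (AdelicGroupData.finiteAdeleEval L w) ∘ (UnitaryGroup.adeleSnd L) from rfl,
    ← Matrix.map_map, show ((((locToAdelic L e dV hdV dW hdW v) y).1 : GL (Fin (n + n)) (AdeleRing (𝓞 L) L)) : Matrix (Fin (n + n)) (Fin (n + n)) (AdeleRing (𝓞 L) L)).map (UnitaryGroup.adeleSnd L) = (((UnitaryGroup.inclPlace (Fp L) L (IsCMField.complexConj L) (n + n) (hermD L e dV hdV dW hdW) v y : UnitaryGroup.finAdelic (Fp L) L (IsCMField.complexConj L) (n + n) (hermD L e dV hdV dW hdW)) : GL (Fin (n + n)) (FiniteAdeleRing (𝓞 L) L)) : Matrix (Fin (n + n)) (Fin (n + n)) (FiniteAdeleRing (𝓞 L) L)) from map_snd_coe_finAdelicToAdelic L e dV hdV dW hdW _,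
    UnitaryGroup.map_eval_eq_evalAt]
  exact coe_evalAt_inclPlace_of_not_over L e dV hdV dW hdW v y w hw

/-- the component of the matrix of `u` at `w ∣ v` is the matrix `(u_v)_w` of the `v`-component `u_v = evalPlace v (finPart u)` (definitional). [cite: CasselsFrohlichANT1967, Ch. XV (Tate), §4.1] -/
theorem map_adeleEval_eq_evalPlace (u : (HA L e dV hdV dW hdW)) (w : UnitaryGroup.PlacesOver L v) :
    (((u : (HA L e dV hdV dW hdW)) : GL (Fin (n + n)) (AdeleRing (𝓞 L) L)) : Matrix (Fin (n + n)) (Fin (n + n)) (AdeleRing (𝓞 L) L)).map (AdelicGroupData.adeleEval L w.1) = ((((((UnitaryGroup.evalPlace (Fp L) L (IsCMField.complexConj L) (n + n) (hermD L e dV hdV dW hdW) v) ((UnitaryGroup.finPart (Fp L) L (IsCMField.complexConj L) (n + n) (hermD L e dV hdV dW hdW)) u)) : (UnitaryGroup.localPi L (IsCMField.complexConj L) (n + n) (hermD L e dV hdV dW hdW) v)) : (UnitaryGroup.LocalGLPi L (n + n) v)) w : GL (Fin (n + n)) (w.1.adicCompletion L)) : Matrix (Fin (n + n)) (Fin (n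 + n)) (w.1.adicCompletion L)) :=
  rfl

end Components

/-! ## §3 The product formula -/

section Product

variable (L : Type) [Field L] [NumberField L] [IsCMField L]
variable {N M n : ℕ} (e : Fin N × Fin M ≃ Fin n)
  (dV : Fin N → L) (hdV : ∀ i, IsCMField.complexConj L (dV i) = dV i)
  (dW : Fin M → L) (hdW : ∀ i, IsCMField.complexConj L (dW i) = dW i)
  (S : Matrix (Fin n) (Fin n) L)

/-- **THE LOCAL CHARACTER `ψ_{S,v} = ψ_S ∘ ι_v` IN COORDINATES**: for `y ∈ H(L⁺_v)`, `ψ_S(ι_v y) = ∏_{w ∣ v} ψ_{L,w}(tr(S_𝔸 · X(ι_v y))_w)` and the `w`-component of that adele is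
`tr(S_w · X(y_w))` (★ Tate 3.2.1 on the adele `(0; (tr S_w X(y_w))_{w∣v}; 0)`). Stated with the factor at `w ∣ v` equal to the `w`-component of ANY adele `x` agreeing there —
used with `x = tr(S_𝔸 X(u))`, `y = u_v`. [cite: CasselsFrohlichANT1967, Ch. XV (Tate), Lemma 3.2.1] [cite: Shimura1997, §18.1 (18.4)] -/
theorem unipDeltaChar_locToAdelic_eq_prod (v : (HeightOneSpectrum (𝓞 (Fp L)))) (y : (UnitaryGroup.localPi L (IsCMField.complexConj L) (n + n) (hermD L e dV hdV dW hdW) v)) :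
    (unipDeltaChar L e dV hdV dW hdW S) ((locToAdelic L e dV hdV dW hdW v) y) =
      ∏ w : UnitaryGroup.PlacesOver L v, (adeleAddChar L).adicComponent w.1
        (Matrix.trace (((S.map (algebraMap L (AdeleRing (𝓞 L) L)))).map (AdelicGroupData.adeleEval L w.1) * (Matrix.reindex (e₂ (n := n)).symm (e₂ (n := n)).symm (((((y : (UnitaryGroup.localPi L (IsCMField.complexConj L) (n + n) (hermD L e dV hdV dW hdW) v)) : (UnitaryGroup.LocalGLPi L (n + n) v)) w : GL (Fin (n + n)) (w.1.adicCompletion L)) : Matrix (Fin (n + n)) (Fin (n + n)) (w.1.adicCompletion L)))).toBlocks₁₂)) := by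
  classical
  have hψ : (unipDeltaChar L e dV hdV dW hdW S) ((locToAdelic L e dV hdV dW hdW v) y) = adeleAddChar L (Matrix.trace ((S.map (algebraMap L (AdeleRing (𝓞 L) L))) * (Matrix.reindex (e₂ (n := n)).symm (e₂ (n := n)).symm ((((locToAdelic L e dV hdV dW hdW v) y).1 : GL (Fin (n + n)) (AdeleRing (𝓞 L) L)) : Matrix (Fin (n + n)) (Fin (n + n)) (AdeleRing (𝓞 L) L))).toBlocks₁₂)) := rfl
  have h1 : (Matrix.trace ((S.map (algebraMap L (AdeleRing (𝓞 L) L))) * (Matrix.reindex (e₂ (n := n)).symm (e₂ (n := n)).symm ((((locToAdelic L e dV hdV dW hdW v) y).1 : GL (Fin (n + n)) (AdeleRing (𝓞 L) L)) : Matrix (Fin (n + n)) (Fin (n + n)) (AdeleRing (𝓞 L) L))).toBlocks₁₂)).1 = 0 := by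
    change UnitaryGroup.adeleFst L _ = 0
    rw [map_trace_mul_toBlocks₁₂, map_fst_locToAdelic, trace_mul_toBlocks₁₂_one]
  have h2 : ∀ w : UnitaryGroup.PlacesOver L v, (Matrix.trace ((S.map (algebraMap L (AdeleRing (𝓞 L) L))) * (Matrix.reindex (e₂ (n := n)).symm (e₂ (n := n)).symm ((((locToAdelic L e dV hdV dW hdW v) y).1 : GL (Fin (n + n)) (AdeleRing (𝓞 L) L)) : Matrix (Fin (n + n)) (Fin (n + n)) (AdeleRing (𝓞 L) L))).toBlocks₁₂)).2 w.1 =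
      Matrix.trace (((S.map (algebraMap L (AdeleRing (𝓞 L) L)))).map (AdelicGroupData.adeleEval L w.1) * (Matrix.reindex (e₂ (n := n)).symm (e₂ (n := n)).symm (((((y : (UnitaryGroup.localPi L (IsCMField.complexConj L) (n + n) (hermD L e dV hdV dW hdW) v)) : (UnitaryGroup.LocalGLPi L (n + n) v)) w : GL (Fin (n + n)) (w.1.adicCompletion L)) : Matrix (Fin (n + n)) (Fin (n + n)) (w.1.adicCompletion L)))).toBlocks₁₂) := fun w => by
    change AdelicGroupData.adeleEval L w.1 _ = _
    rw [map_trace_mul_toBlocks₁₂, map_adeleEval_locToAdelic_of_over]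
  have h3 : ∀ w : (HeightOneSpectrum (𝓞 L)), w.under (𝓞 (Fp L)) ≠ v → (Matrix.trace ((S.map (algebraMap L (AdeleRing (𝓞 L) L))) * (Matrix.reindex (e₂ (n := n)).symm (e₂ (n := n)).symm ((((locToAdelic L e dV hdV dW hdW v) y).1 : GL (Fin (n + n)) (AdeleRing (𝓞 L) L)) : Matrix (Fin (n + n)) (Fin (n + n)) (AdeleRing (𝓞 L) L))).toBlocks₁₂)).2 w = 0 := fun w hw => by
    change AdelicGroupData.adeleEval L w _ = 0
    rw [map_trace_mul_toBlocks₁₂, map_adeleEval_locToAdelic_of_not_over L e dV hdV dW hdW v y w hw, trace_mul_toBlocks₁₂_one]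
  rw [hψ, map_eq_mul_finprod_adicComponent (continuous_adeleAddChar L), h1, map_zero (infiniteAdeleInl L), AddChar.map_zero_eq_one, one_mul,
    finprod_eq_prod_of_mulSupport_subset _ (s := (Finset.univ : Finset (UnitaryGroup.PlacesOver L v)).map (Function.Embedding.subtype _)) ?_]
  · rw [Finset.prod_map]
    refine Finset.prod_congr rfl fun w _ => ?_
    rw [Function.Embedding.coe_subtype, h2]
  · intro w hw
    rw [Function.mem_mulSupport] at hw
    have hwv : w.under (𝓞 (Fp L)) = v := by
      by_contra h
      exact hw (by rw [h3 w h, AddChar.map_zero_eq_one])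
    exact Finset.mem_coe.2 (Finset.mem_map.2 ⟨⟨w, hwv⟩, Finset.mem_univ _, rfl⟩)

/-- **THE ARCHIMEDEAN FACTOR**: `ψ_S(u_∞, 1) = ψ_L(tr(S_𝔸 X(u))_∞, 0)` (★ Tate 3.2.1: the finite components of `tr(S_𝔸 X(u_∞,1))` vanish, its archimedean one is that of
`tr(S_𝔸 X(u))`). [cite: CasselsFrohlichANT1967, Ch. XV (Tate), Lemma 3.2.1] -/
theorem unipDeltaChar_archToAdelic_archPart (u : (HA L e dV hdV dW hdW)) :
    (unipDeltaChar L e dV hdV dW hdW S) ((UnitaryGroup.archToAdelic (Fp L) L (IsCMField.complexConj L) (n + n) (hermD L e dV hdV dW hdW)) ((UnitaryGroup.archPart (Fp L) L (IsCMField.complexConj L) (n + n) (hermD L e dV hdV dW hdW)) u)) = adeleAddChar L (infiniteAdeleInl L ((Matrix.trace ((S.map (algebraMap L (AdeleRing (𝓞 L) L))) * (Matrix.reindex (e₂ (n := n)).symm (e₂ (n := n)).symm (((u : (HA L e dV hdV dW hdW)) : GL (Fin (n + n)) (AdeleRing (𝓞 L) L)) : Matrix (Fin (n + n)) (Fin (n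 + n)) (AdeleRing (𝓞 L) L))).toBlocks₁₂))).1) := by
  have hψ : (unipDeltaChar L e dV hdV dW hdW S) ((UnitaryGroup.archToAdelic (Fp L) L (IsCMField.complexConj L) (n + n) (hermD L e dV hdV dW hdW)) ((UnitaryGroup.archPart (Fp L) L (IsCMField.complexConj L) (n + n) (hermD L e dV hdV dW hdW)) u)) = adeleAddChar L (Matrix.trace ((S.map (algebraMap L (AdeleRing (𝓞 L) L))) * (Matrix.reindex (e₂ (n := n)).symm (e₂ (n := n)).symm ((((UnitaryGroup.archToAdelic (Fp L) L (IsCMField.complexConj L) (n + n) (hermD L e dV hdV dW hdW)) ((UnitaryGroup.archPart (Fp L) L (IsCMField.complexConj L) (n + n) (hermD L e dV hdV dW hdW)) u)).1 : GL (Fin (n + n)) (AdeleRing (𝓞 L) L)) : Matrix (Fin (n + n)) (Fin (n + n)) (AdeleRing (𝓞 L) L))).toBlocks₁₂)) := rfl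
  have h1 : (Matrix.trace ((S.map (algebraMap L (AdeleRing (𝓞 L) L))) * (Matrix.reindex (e₂ (n := n)).symm (e₂ (n := n)).symm ((((UnitaryGroup.archToAdelic (Fp L) L (IsCMField.complexConj L) (n + n) (hermD L e dV hdV dW hdW)) ((UnitaryGroup.archPart (Fp L) L (IsCMField.complexConj L) (n + n) (hermD L e dV hdV dW hdW)) u)).1 : GL (Fin (n + n)) (AdeleRing (𝓞 L) L)) : Matrix (Fin (n + n)) (Fin (n + n)) (AdeleRing (𝓞 L) L))).toBlocks₁₂)).1 = (Matrix.trace ((S.map (algebraMap L (AdeleRing (𝓞 L) L))) * (Matrix.reindex (e₂ (n := n)).symm (e₂ (n := n)).symm (((u : (HA L e dV hdV dW hdW)) : GL (Fin (n + n)) (AdeleRing (𝓞 L) L)) : Matrix (Fin (n + n)) (Fin (n + n)) (AdeleRing (𝓞 L) L))).toBlocks₁₂)).1 := by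
    change UnitaryGroup.adeleFst L _ = UnitaryGroup.adeleFst L _
    rw [map_trace_mul_toBlocks₁₂, map_trace_mul_toBlocks₁₂, map_fst_archToAdelic_archPart]
  have h2 : ∀ w : (HeightOneSpectrum (𝓞 L)), (Matrix.trace ((S.map (algebraMap L (AdeleRing (𝓞 L) L))) * (Matrix.reindex (e₂ (n := n)).symm (e₂ (n := n)).symm ((((UnitaryGroup.archToAdelic (Fp L) L (IsCMField.complexConj L) (n + n) (hermD L e dV hdV dW hdW)) ((UnitaryGroup.archPart (Fp L) L (IsCMField.complexConj L) (n + n) (hermD L e dV hdV dW hdW)) u)).1 : GL (Fin (n + n)) (AdeleRing (𝓞 L) L)) : Matrix (Fin (n + n)) (Fin (n + n)) (AdeleRing (𝓞 L) L))).toBlocks₁₂)).2 w = 0 := fun w => by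
    change AdelicGroupData.adeleEval L w _ = 0
    rw [map_trace_mul_toBlocks₁₂, map_adeleEval_archToAdelic_archPart, trace_mul_toBlocks₁₂_one]
  rw [hψ, map_eq_mul_finprod_adicComponent (continuous_adeleAddChar L), h1]
  have h3 : (fun w : (HeightOneSpectrum (𝓞 L)) => (adeleAddChar L).adicComponent w ((Matrix.trace ((S.map (algebraMap L (AdeleRing (𝓞 L) L))) * (Matrix.reindex (e₂ (n := n)).symm (e₂ (n := n)).symm ((((UnitaryGroup.archToAdelic (Fp L) L (IsCMField.complexConj L) (n + n) (hermD L e dV hdV dW hdW)) ((UnitaryGroup.archPart (Fp L) L (IsCMField.complexConj L) (n + n) (hermD L e dV hdV dW hdW)) u)).1 : GL (Fin (n + n)) (AdeleRing (𝓞 L) L)) : Matrix (Fin (n + n)) (Fin (n + n)) (AdeleRing (𝓞 L) L))).toBlocks₁₂)).2 w)) = fun _ => 1 :=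
    funext fun w => by rw [h2, AddChar.map_zero_eq_one]
  rw [h3, finprod_one, mul_one]

/-- the local factor at `v` of the product formula in terms of the adele `x = tr(S_𝔸 X(u))`: `ψ_S(ι_v u_v) = ∏_{w∣v} ψ_{L,w}(x_w)` (§2 `map_adeleEval_eq_evalPlace`).
[cite: CasselsFrohlichANT1967, Ch. XV (Tate), Lemma 3.2.1] -/
theorem unipDeltaChar_locToAdelic_evalPlace_eq_prod (u : (HA L e dV hdV dW hdW)) (v : (HeightOneSpectrum (𝓞 (Fp L)))) :
    (unipDeltaChar L e dV hdV dW hdW S) ((locToAdelic L e dV hdV dW hdW v) ((UnitaryGroup.evalPlace (Fp L) L (IsCMField.complexConj L) (n + n) (hermD L e dV hdV dW hdW) v) ((UnitaryGroup.finPart (Fp L) L (IsCMField.complexConj L) (n + n) (hermD L e dV hdV dW hdW)) u))) =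
      ∏ w : UnitaryGroup.PlacesOver L v, (adeleAddChar L).adicComponent w.1 ((Matrix.trace ((S.map (algebraMap L (AdeleRing (𝓞 L) L))) * (Matrix.reindex (e₂ (n := n)).symm (e₂ (n := n)).symm (((u : (HA L e dV hdV dW hdW)) : GL (Fin (n + n)) (AdeleRing (𝓞 L) L)) : Matrix (Fin (n + n)) (Fin (n + n)) (AdeleRing (𝓞 L) L))).toBlocks₁₂)).2 w.1) := by
  rw [unipDeltaChar_locToAdelic_eq_prod]
  refine Finset.prod_congr rfl fun w _ => ?_
  congr 1
  change _ = AdelicGroupData.adeleEval L w.1 _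
  rw [map_trace_mul_toBlocks₁₂, map_adeleEval_eq_evalPlace]

/-- almost all the factors `ψ_{L,w}(tr(S_𝔸 X(u))_w)` are `1` (`x_w ∈ 𝒪_w` for almost all `w`, ★ `adeleAddCharAt_eq_one_of_mem`). [cite: CasselsFrohlichANT1967, Ch. XV (Tate), Lemma 3.2.1] -/
theorem finite_mulSupport_adicComponent_trace (u : (HA L e dV hdV dW hdW)) :
    (Function.mulSupport fun w : (HeightOneSpectrum (𝓞 L)) => (adeleAddChar L).adicComponent w ((Matrix.trace ((S.map (algebraMap L (AdeleRing (𝓞 L) L))) * (Matrix.reindex (e₂ (n := n)).symm (e₂ (n := n)).symm (((u : (HA L e dV hdV dW hdW)) : GL (Fin (n + n)) (AdeleRing (𝓞 L) L)) : Matrix (Fin (n + n)) (Fin (n + n)) (AdeleRing (𝓞 L) L))).toBlocks₁₂)).2 w)).Finite := by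
  refine (Filter.eventually_cofinite.1 ((Matrix.trace ((S.map (algebraMap L (AdeleRing (𝓞 L) L))) * (Matrix.reindex (e₂ (n := n)).symm (e₂ (n := n)).symm (((u : (HA L e dV hdV dW hdW)) : GL (Fin (n + n)) (AdeleRing (𝓞 L) L)) : Matrix (Fin (n + n)) (Fin (n + n)) (AdeleRing (𝓞 L) L))).toBlocks₁₂)).2).2).subset fun w hw => ?_
  rw [Function.mem_mulSupport] at hw
  exact fun hint => hw (adeleAddCharAt_eq_one_of_mem L w hint)

/-- **almost all local factors `ψ_S(ι_v u_v)` are `1`.** [cite: CasselsFrohlichANT1967, Ch. XV (Tate), Lemma 3.2.1] -/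
theorem finite_mulSupport_unipDeltaChar_locToAdelic (u : (HA L e dV hdV dW hdW)) :
    (Function.mulSupport fun v : (HeightOneSpectrum (𝓞 (Fp L))) => (unipDeltaChar L e dV hdV dW hdW S) ((locToAdelic L e dV hdV dW hdW v) ((UnitaryGroup.evalPlace (Fp L) L (IsCMField.complexConj L) (n + n) (hermD L e dV hdV dW hdW) v) ((UnitaryGroup.finPart (Fp L) L (IsCMField.complexConj L) (n + n) (hermD L e dV hdV dW hdW)) u)))).Finite := by
  classical
  refine ((finite_mulSupport_adicComponent_trace L e dV hdV dW hdW S u).toFinset.image fun w : (HeightOneSpectrum (𝓞 L)) => w.under (𝓞 (Fp L))).finite_toSet.subset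
    fun v hv => ?_
  rw [Function.mem_mulSupport, unipDeltaChar_locToAdelic_evalPlace_eq_prod] at hv
  obtain ⟨w, -, hw⟩ := Finset.exists_ne_one_of_prod_ne_one hv
  exact Finset.mem_coe.2 (Finset.mem_image.2 ⟨w.1, (Set.Finite.mem_toFinset _).2 hw, w.2⟩)

/-- **THE PRODUCT FORMULA FOR THE UNIPOTENT CHARACTER**: for every `u ∈ H(𝔸)` and `S ∈ M_n(L)`,
`ψ_S(u) = ψ_S(u_∞, 1) · ∏ᶠ_v ψ_S(ι_v u_v)`, `u_v = evalPlace v (finPart u)`, almost all factors being `1` — i.e. `ψ_S = ψ_{S,∞} ⊗ ⊗'_v ψ_{S,v}` with the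
definition-free local characters `ψ_{S,v} = ψ_S ∘ ι_v` (★ Tate's Lemma 3.2.1 for `ψ_L` at the adele `tr(S_𝔸 X(u))`, regrouped over the places of `L⁺` by §1, with §2).
[cite: CasselsFrohlichANT1967, Ch. XV (Tate), Lemma 3.2.1] [cite: Shimura1997, §18.1 (18.4)] [cite: KudlaRallis1994, §2] -/
theorem unipDeltaChar_eq_archPart_mul_finprod (u : (HA L e dV hdV dW hdW)) :
    (unipDeltaChar L e dV hdV dW hdW S) u = (unipDeltaChar L e dV hdV dW hdW S) ((UnitaryGroup.archToAdelic (Fp L) L (IsCMField.complexConj L) (n + n) (hermD L e dV hdV dW hdW)) ((UnitaryGroup.archPart (Fp L) L (IsCMField.complexConj L) (n + n) (hermD L e dV hdV dW hdW)) u)) *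
      ∏ᶠ v : (HeightOneSpectrum (𝓞 (Fp L))), (unipDeltaChar L e dV hdV dW hdW S) ((locToAdelic L e dV hdV dW hdW v) ((UnitaryGroup.evalPlace (Fp L) L (IsCMField.complexConj L) (n + n) (hermD L e dV hdV dW hdW) v) ((UnitaryGroup.finPart (Fp L) L (IsCMField.complexConj L) (n + n) (hermD L e dV hdV dW hdW)) u))) := by
  classical
  have hψ : (unipDeltaChar L e dV hdV dW hdW S) u = adeleAddChar L (Matrix.trace ((S.map (algebraMap L (AdeleRing (𝓞 L) L))) * (Matrix.reindex (e₂ (n := n)).symm (e₂ (n := n)).symm (((u : (HA L e dV hdV dW hdW)) : GL (Fin (n + n)) (AdeleRing (𝓞 L) L)) : Matrix (Fin (n + n)) (Fin (n + n)) (AdeleRing (𝓞 L) L))).toBlocks₁₂)) := rfl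
  rw [hψ, map_eq_mul_finprod_adicComponent (continuous_adeleAddChar L), ← unipDeltaChar_archToAdelic_archPart,
    finprod_eq_finprod_prod_fiber (fun w : (HeightOneSpectrum (𝓞 L)) => w.under (𝓞 (Fp L))) _ (finite_mulSupport_adicComponent_trace L e dV hdV dW hdW S u)]
  congr 1
  exact finprod_congr fun v => (unipDeltaChar_locToAdelic_evalPlace_eq_prod L e dV hdV dW hdW S u v).symm

/-- the product formula, complex-valued. [cite: CasselsFrohlichANT1967, Ch. XV (Tate), Lemma 3.2.1] -/
theorem coe_unipDeltaChar_eq_archPart_mul_finprod (u : (HA L e dV hdV dW hdW)) :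
    (((unipDeltaChar L e dV hdV dW hdW S) u : Circle) : ℂ) = (((unipDeltaChar L e dV hdV dW hdW S) ((UnitaryGroup.archToAdelic (Fp L) L (IsCMField.complexConj L) (n + n) (hermD L e dV hdV dW hdW)) ((UnitaryGroup.archPart (Fp L) L (IsCMField.complexConj L) (n + n) (hermD L e dV hdV dW hdW)) u)) : Circle) : ℂ) *
      ∏ᶠ v : (HeightOneSpectrum (𝓞 (Fp L))), (((unipDeltaChar L e dV hdV dW hdW S) ((locToAdelic L e dV hdV dW hdW v) ((UnitaryGroup.evalPlace (Fp L) L (IsCMField.complexConj L) (n + n) (hermD L e dV hdV dW hdW) v) ((UnitaryGroup.finPart (Fp L) L (IsCMField.complexConj L) (n + n) (hermD L e dV hdV dW hdW)) u))) : Circle) : ℂ) := by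
  rw [unipDeltaChar_eq_archPart_mul_finprod, Circle.coe_mul]
  congr 1
  exact Circle.coeHom.map_finprod (finite_mulSupport_unipDeltaChar_locToAdelic L e dV hdV dW hdW S u)

/-- splitting a finitely supported product along a finite set `T` and its complement (the `T`-bookkeeping of the (F)-shape of ★ Φ3c). [cite: CasselsFrohlichANT1967, Ch. XV (Tate), §3.3] -/
theorem finprod_eq_prod_mul_finprod_subtype {κ R : Type*} [CommMonoid R] (T : Finset κ) (F : κ → R) (hF : (Function.mulSupport F).Finite) :
    ∏ᶠ k, F k = (∏ k ∈ T, F k) * ∏ᶠ k : {k // k ∉ T}, F k.1 := by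
  classical
  rw [finprod_subtype_eq_finprod_cond, ← finprod_mem_univ, ← Set.union_compl_self (↑T : Set κ),
    finprod_mem_union' disjoint_compl_right (hF.subset Set.inter_subset_right) (hF.subset Set.inter_subset_right), finprod_mem_coe_finset]
  rfl

/-- **THE PRODUCT FORMULA IN `unipDeltaSplit` COORDINATES** (`(unipDeltaSplit u).1 = u_∞`, `((unipDeltaSplit u).2)_v = u_v`, ★ by `rfl`), for `u ∈ N_Δ(𝔸)`.
[cite: CasselsFrohlichANT1967, Ch. XV (Tate), Lemma 3.2.1] [cite: KudlaRallis1994, §2] -/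
theorem unipDeltaChar_eq_mul_finprod_split (u : ↥(unipDelta L e dV hdV dW hdW)) :
    (unipDeltaChar L e dV hdV dW hdW S) (u : (HA L e dV hdV dW hdW)) =
      (unipDeltaChar L e dV hdV dW hdW S) ((UnitaryGroup.archToAdelic (Fp L) L (IsCMField.complexConj L) (n + n) (hermD L e dV hdV dW hdW)) (((unipDeltaSplit L e dV hdV dW hdW) u).1 : UnitaryGroup.arch (Fp L) L (IsCMField.complexConj L) (n + n) (hermD L e dV hdV dW hdW))) *
        ∏ᶠ v : (HeightOneSpectrum (𝓞 (Fp L))), (unipDeltaChar L e dV hdV dW hdW S) ((locToAdelic L e dV hdV dW hdW v) ((((unipDeltaSplit L e dV hdV dW hdW) u).2 v : ↥(unipDeltaLoc L e dV hdV dW hdW v)) : (UnitaryGroup.localPi L (IsCMField.complexConj L) (n + n) (hermD L e dV hdV dW hdW) v))) :=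
  unipDeltaChar_eq_archPart_mul_finprod L e dV hdV dW hdW S (u : (HA L e dV hdV dW hdW))

set_option maxHeartbeats 800000 in -- MEASURED: `rw … at h1` re-checks the motive of the long (F)-shape equation (default 200000 times out; 800000 passes)
/-- the (F)-shape with the `T`-split for the conj'd character, `u ∈ H(𝔸)`, in `archPart ∕ evalPlace ∘ finPart` letters. [cite: CasselsFrohlichANT1967, Ch. XV (Tate), Lemma 3.2.1] -/
theorem conj_unipDeltaChar_eq_mul_finprod_off' (T : Finset (HeightOneSpectrum (𝓞 (Fp L)))) (u : (HA L e dV hdV dW hdW)) :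
    (starRingEnd ℂ) (((unipDeltaChar L e dV hdV dW hdW S) u : Circle) : ℂ) =
      ((starRingEnd ℂ) (((unipDeltaChar L e dV hdV dW hdW S) ((UnitaryGroup.archToAdelic (Fp L) L (IsCMField.complexConj L) (n + n) (hermD L e dV hdV dW hdW)) ((UnitaryGroup.archPart (Fp L) L (IsCMField.complexConj L) (n + n) (hermD L e dV hdV dW hdW)) u)) : Circle) : ℂ) *
          ∏ v : T, (starRingEnd ℂ) (((unipDeltaChar L e dV hdV dW hdW S) ((locToAdelic L e dV hdV dW hdW v.1) ((UnitaryGroup.evalPlace (Fp L) L (IsCMField.complexConj L) (n + n) (hermD L e dV hdV dW hdW) v.1) ((UnitaryGroup.finPart (Fp L) L (IsCMField.complexConj L) (n + n) (hermD L e dV hdV dW hdW)) u))) : Circle) : ℂ)) *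
        ∏ᶠ v : {v : (HeightOneSpectrum (𝓞 (Fp L))) // v ∉ T}, (starRingEnd ℂ) (((unipDeltaChar L e dV hdV dW hdW S) ((locToAdelic L e dV hdV dW hdW v.1) ((UnitaryGroup.evalPlace (Fp L) L (IsCMField.complexConj L) (n + n) (hermD L e dV hdV dW hdW) v.1) ((UnitaryGroup.finPart (Fp L) L (IsCMField.complexConj L) (n + n) (hermD L e dV hdV dW hdW)) u))) : Circle) : ℂ) := by
  have hfinC : (Function.mulSupport fun v : (HeightOneSpectrum (𝓞 (Fp L))) => (((unipDeltaChar L e dV hdV dW hdW S) ((locToAdelic L e dV hdV dW hdW v) ((UnitaryGroup.evalPlace (Fp L) L (IsCMField.complexConj L) (n + n) (hermD L e dV hdV dW hdW) v) ((UnitaryGroup.finPart (Fp L) L (IsCMField.complexConj L) (n + n) (hermD L e dV hdV dW hdW)) u))) : Circle) : ℂ)).Finite := by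
    refine (finite_mulSupport_unipDeltaChar_locToAdelic L e dV hdV dW hdW S u).subset fun v hv => ?_
    rw [Function.mem_mulSupport] at hv ⊢
    exact fun h => hv (by rw [h, Circle.coe_one])
  have hfin : (Function.mulSupport fun v : (HeightOneSpectrum (𝓞 (Fp L))) =>
      (starRingEnd ℂ) (((unipDeltaChar L e dV hdV dW hdW S) ((locToAdelic L e dV hdV dW hdW v) ((UnitaryGroup.evalPlace (Fp L) L (IsCMField.complexConj L) (n + n) (hermD L e dV hdV dW hdW) v) ((UnitaryGroup.finPart (Fp L) L (IsCMField.complexConj L) (n + n) (hermD L e dV hdV dW hdW)) u))) : Circle) : ℂ)).Finite := by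
    refine hfinC.subset fun v hv => ?_
    rw [Function.mem_mulSupport] at hv ⊢
    exact fun h => hv (by rw [h, map_one])
  have h1 := congrArg (starRingEnd ℂ) (coe_unipDeltaChar_eq_archPart_mul_finprod L e dV hdV dW hdW S u)
  rw [map_mul, map_finprod (starRingEnd ℂ) hfinC, finprod_eq_prod_mul_finprod_subtype T _ hfin, ← Finset.prod_coe_sort T, ← mul_assoc] at h1
  exact h1

/-- **THE (F)-SHAPE OF ★ Φ3c FOR THE INTEGRAND FACTOR `conj ψ_S`** — exactly the letter `hψ` of ★ (d3) `K2LiuWhittakerDeltaEulerHead.whittakerDelta_eq_mul_tprod` with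
`ΨT (a, x) := conj ψ_S(a, 1) · ∏_{v ∈ T} conj ψ_S(ι_v x_v)` and `Ψv v y := conj ψ_S(ι_v y)` (`unipDeltaSplit` coordinates, ★ `rfl` lemmas `coe_unipDeltaSplit_fst∕_snd_apply`): for every finite `T`
and `u ∈ N_Δ(𝔸)`, `conj ψ_S(u) = (conj ψ_S(u_∞,1) · ∏_{v∈T} conj ψ_S(ι_v u_v)) · ∏ᶠ_{v∉T} conj ψ_S(ι_v u_v)`. [cite: CasselsFrohlichANT1967, Ch. XV (Tate), Lemma 3.2.1] [cite: Tan1999, §3] -/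
theorem conj_unipDeltaChar_eq_mul_finprod_off (T : Finset (HeightOneSpectrum (𝓞 (Fp L)))) (u : ↥(unipDelta L e dV hdV dW hdW)) :
    (starRingEnd ℂ) (((unipDeltaChar L e dV hdV dW hdW S) (u : (HA L e dV hdV dW hdW)) : Circle) : ℂ) =
      ((starRingEnd ℂ) (((unipDeltaChar L e dV hdV dW hdW S) ((UnitaryGroup.archToAdelic (Fp L) L (IsCMField.complexConj L) (n + n) (hermD L e dV hdV dW hdW)) (((unipDeltaSplit L e dV hdV dW hdW) u).1 : UnitaryGroup.arch (Fp L) L (IsCMField.complexConj L) (n + n) (hermD L e dV hdV dW hdW))) : Circle) : ℂ) *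
          ∏ v : T, (starRingEnd ℂ) (((unipDeltaChar L e dV hdV dW hdW S) ((locToAdelic L e dV hdV dW hdW v.1) ((((unipDeltaSplit L e dV hdV dW hdW) u).2 v.1 : ↥(unipDeltaLoc L e dV hdV dW hdW v.1)) : (UnitaryGroup.localPi L (IsCMField.complexConj L) (n + n) (hermD L e dV hdV dW hdW) v.1))) : Circle) : ℂ)) *
        ∏ᶠ v : {v : (HeightOneSpectrum (𝓞 (Fp L))) // v ∉ T}, (starRingEnd ℂ) (((unipDeltaChar L e dV hdV dW hdW S) ((locToAdelic L e dV hdV dW hdW v.1) ((((unipDeltaSplit L e dV hdV dW hdW) u).2 v.1 : ↥(unipDeltaLoc L e dV hdV dW hdW v.1)) : (UnitaryGroup.localPi L (IsCMField.complexConj L) (n + n) (hermD L e dV hdV dW hdW) v.1))) : Circle) : ℂ) :=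
  conj_unipDeltaChar_eq_mul_finprod_off' L e dV hdV dW hdW S T (u : (HA L e dV hdV dW hdW))

end Product

/-! ## §4 Unramified places: `ψ_{S,v} ≡ 1` on `K_{H,v} ∩ N_Δ(L⁺_v)` wherever `S` is integral -/

section Unramified

variable (L : Type) [Field L] [NumberField L] [IsCMField L]
variable {N M n : ℕ} (e : Fin N × Fin M ≃ Fin n)
  (dV : Fin N → L) (hdV : ∀ i, IsCMField.complexConj L (dV i) = dV i)
  (dW : Fin M → L) (hdW : ∀ i, IsCMField.complexConj L (dW i) = dW i)
  (S : Matrix (Fin n) (Fin n) L)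

/-- **`ψ_{S,v}` IS UNRAMIFIED WHERE `S` IS INTEGRAL**: if every entry of `S` is `w`-integral for all `w ∣ v`, then `ψ_S(ι_v k) = 1` for every `k ∈ K_{H,v} ∩ N_Δ(L⁺_v)` — indeed for
every `k ∈ H(L⁺_v)` with all `k_w ∈ GL_{n+n}(𝒪_w)` (`tr(S_w X(k_w)) ∈ 𝒪_w` and Tate's `ψ_{L,w}` is trivial on `𝒪_w` at EVERY `w`, ★ `adeleAddCharAt_eq_one_of_mem`; no condition on the
different).  This is the letter `hψK` of ★ (d3). [cite: CasselsFrohlichANT1967, Ch. XV (Tate), Lemma 3.2.1, Lemma 2.2.3] [cite: Shimura1997, §18.3] -/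
theorem unipDeltaChar_locToAdelic_eq_one_of_integral (v : (HeightOneSpectrum (𝓞 (Fp L))))
    (hS : ∀ (w : UnitaryGroup.PlacesOver L v) (i j : Fin n), ((S i j : L) : w.1.adicCompletion L) ∈ w.1.adicCompletionIntegers L)
    (k : ↥(unipDeltaLoc L e dV hdV dW hdW v)) (hk : k ∈ (inH (fun v => UnitaryGroup.localInt L (IsCMField.complexConj L) (n + n) (hermD L e dV hdV dW hdW) v) (fun v => unipDeltaLoc L e dV hdV dW hdW v) v)) :
    (unipDeltaChar L e dV hdV dW hdW S) ((locToAdelic L e dV hdV dW hdW v) (k : (UnitaryGroup.localPi L (IsCMField.complexConj L) (n + n) (hermD L e dV hdV dW hdW) v))) = 1 := by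
  rw [unipDeltaChar_locToAdelic_eq_prod]
  refine Finset.prod_eq_one fun w _ => adeleAddCharAt_eq_one_of_mem L w.1 ?_
  have hkw := (UnitaryGroup.mem_localInt_iff L (IsCMField.complexConj L) (n + n) (hermD L e dV hdV dW hdW) v (k : (UnitaryGroup.localPi L (IsCMField.complexConj L) (n + n) (hermD L e dV hdV dW hdW) v))).1
    (Subgroup.mem_subgroupOf.1 hk) w
  rw [mem_glInt_iff] at hkw
  rw [Matrix.trace]
  refine sum_mem fun i _ => ?_
  rw [Matrix.diag_apply, Matrix.mul_apply]
  refine sum_mem fun j _ => mul_mem ?_ ?_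
  · exact hS w i j
  · have hX : (Matrix.reindex (e₂ (n := n)).symm (e₂ (n := n)).symm ((((((k : (UnitaryGroup.localPi L (IsCMField.complexConj L) (n + n) (hermD L e dV hdV dW hdW) v)) : (UnitaryGroup.localPi L (IsCMField.complexConj L) (n + n) (hermD L e dV hdV dW hdW) v)) : (UnitaryGroup.LocalGLPi L (n + n) v)) w : GL (Fin (n + n)) (w.1.adicCompletion L)) : Matrix (Fin (n + n)) (Fin (n + n)) (w.1.adicCompletion L)))).toBlocks₁₂ j i =
        (((((k : (UnitaryGroup.localPi L (IsCMField.complexConj L) (n + n) (hermD L e dV hdV dW hdW) v)) : (UnitaryGroup.localPi L (IsCMField.complexConj L) (n + n) (hermD L e dV hdV dW hdW) v)) : (UnitaryGroup.LocalGLPi L (n + n) v)) w : GL (Fin (n + n)) (w.1.adicCompletion L)) : Matrix (Fin (n + n)) (Fin (n + n)) (w.1.adicCompletion L)) ((e₂ (n := n)) (Sum.inl j)) ((e₂ (n := n)) (Sum.inr i)) := rfl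
    rw [hX]
    exact (HeightOneSpectrum.mem_adicCompletionIntegers _ _ _).2 ((Valuation.mem_integer_iff _ _).1
      ((mem_valuationInteger_iff_mem_valuedInteger L w.1 _).1 (hkw.1 ((e₂ (n := n)) (Sum.inl j)) ((e₂ (n := n)) (Sum.inr i)))))

omit [IsCMField L] in
/-- **`S ∈ M_n(L)` is integral at all places above `v` for `v` off a finite set** (each entry of `S` is a `w`-adic integer for almost all `w` — the finite adele `S_{ij} ⊗ 1`).
[cite: CasselsFrohlichANT1967, Ch. XV (Tate), §3.1] -/
theorem exists_finset_forall_integral :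
    ∃ T₀ : Finset (HeightOneSpectrum (𝓞 (Fp L))), ∀ v, v ∉ T₀ → ∀ (w : UnitaryGroup.PlacesOver L v) (i j : Fin n),
      ((S i j : L) : w.1.adicCompletion L) ∈ w.1.adicCompletionIntegers L := by
  classical
  have hfin : ∀ i j : Fin n, {w : (HeightOneSpectrum (𝓞 L)) | ¬ ((S i j : L) : w.adicCompletion L) ∈ w.adicCompletionIntegers L}.Finite := fun i j =>
    Filter.eventually_cofinite.1 (algebraMap L (FiniteAdeleRing (𝓞 L) L) (S i j)).2
  have hB : (⋃ i : Fin n, ⋃ j : Fin n, {w : (HeightOneSpectrum (𝓞 L)) | ¬ ((S i j : L) : w.adicCompletion L) ∈ w.adicCompletionIntegers L}).Finite :=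
    Set.finite_iUnion fun i => Set.finite_iUnion fun j => hfin i j
  refine ⟨hB.toFinset.image fun w : (HeightOneSpectrum (𝓞 L)) => w.under (𝓞 (Fp L)), fun v hv w i j => ?_⟩
  by_contra h
  exact hv (Finset.mem_image.2 ⟨w.1, hB.mem_toFinset.2 (Set.mem_iUnion.2 ⟨i, Set.mem_iUnion.2 ⟨j, h⟩⟩), w.2⟩)

/-- **`hψK` OFF A FINITE SET**: there is a finite set `T₀ = T₀(S)` of places of `L⁺` such that `conj ψ_S(ι_v k) = 1` for all `v ∉ T₀` and `k ∈ K_{H,v} ∩ N_Δ(L⁺_v)` (the letter `hψK` of ★ (d3)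
for every `T ⊇ T₀`). [cite: CasselsFrohlichANT1967, Ch. XV (Tate), Lemma 3.2.1] [cite: Shimura1997, §18.3] -/
theorem exists_finset_conj_unipDeltaChar_locToAdelic_eq_one :
    ∃ T₀ : Finset (HeightOneSpectrum (𝓞 (Fp L))), ∀ v, v ∉ T₀ → ∀ k : ↥(unipDeltaLoc L e dV hdV dW hdW v), k ∈ (inH (fun v => UnitaryGroup.localInt L (IsCMField.complexConj L) (n + n) (hermD L e dV hdV dW hdW) v) (fun v => unipDeltaLoc L e dV hdV dW hdW v) v) →
      (starRingEnd ℂ) (((unipDeltaChar L e dV hdV dW hdW S) ((locToAdelic L e dV hdV dW hdW v) (k : (UnitaryGroup.localPi L (IsCMField.complexConj L) (n + n) (hermD L e dV hdV dW hdW) v))) : Circle) : ℂ) = 1 := by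
  obtain ⟨T₀, hT₀⟩ := exists_finset_forall_integral L S
  refine ⟨T₀, fun v hv k hk => ?_⟩
  rw [unipDeltaChar_locToAdelic_eq_one_of_integral L e dV hdV dW hdW S v (hT₀ v hv) k hk, Circle.coe_one, map_one]

end Unramified


end Summit.HodgeConjecture.HodgeConjecture.Cruxes.HLiu418.K2LiuSiegelUnipotentCharacterFactorisation

end
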